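import Summits.AtomisticToContinuum.Crystallization.Theorems.PricedLinkCensusTruncatedCensusGapBarlowIdentTruncLJ
import Summits.AtomisticToContinuum.Crystallization.Theorems.PricedLinkCensusTruncatedCensusGapBarlowLayerSumsWindow
import Summits.AtomisticToContinuum.Crystallization.Theorems.PricedLinkCensusTruncatedCensusGapStrainedMarginCert
import Summits.AtomisticToContinuum.Crystallization.Theorems.PricedLinkCensusTruncatedCensusGapHcpLeBarlow
import Summits.AtomisticToContinuum.Crystallization.Theorems.PricedLinkCensusTruncatedCensusGapPeriodicStability

/-!
# The strained-Barlow margin (N1 of the near/far split of `TruncatedCensusGap`) — PROVED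

Route `PricedLinkCensus`, crux `TruncatedCensusGap` (stmt-AtomisticToContinuum-14230), line `near-far-split`
(`Cruxes/TruncatedCensusGap/Lines/near_far_split.lean`).  **N1 `StrainedBarlowMargin`**: every periodic Barlow
stacking `barlowPeriodicConfiguration s a h p` in the near-window (`a ∈ [0.93, 1.02]`, `h ∈ [0.78a, 0.86a]`)
whose spacing ratio lies outside the lever window (`h ≤ 0.808a ∨ 0.825a ≤ h`) has `V_χ` energy per
particle `≥ e_χ* + μ`, `μ = 1/20000 > 0`.

Proof (the glue of the lead's reshape r1, now importable): by the energy identity (p129723) and the AFFINE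
STACKING LAW (p129223) `e(word) = e₀(a,h) + J₂(a,h) · α`, `α = alignedFrequency s p 2 ∈ [0, 1]`, so
`e(word) ≥ min (F_fcc, F_hcp)(a,h)` once the lattice sums are written as class sums (N1a
`stub_barlowLayerSumsWindow`, p167941); the certified box computation N1b (`stub_strainedMarginCert`,
p168897) gives `min (F_fcc, F_hcp)(a,h) ≥ F_hcp(0.977, 0.797) + μ` on the strained window; and
`F_hcp(0.977, 0.797) = e(hcp 0.977 0.797) ≥ e_χ*` by `ciInf_le` under `stub_periodicStability` (p84999).
-/

noncomputable section

namespace Summit.AtomisticToContinuum.Crystallization.Theorems.PricedLinkCensusTruncatedCensusGap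

open Literature.MathematicalPhysics.StatisticalMechanics

/-- **N1 `strainedBarlowMargin`** (registered sub-goal; the statement `StrainedBarlowMargin` of the line
`near-far-split` verbatim): strained periodic Barlow stackings of the near-window sit `≥ μ > 0` above the
periodic `V_χ`-infimum. -/
theorem strainedBarlowMargin : ∃ μ : ℝ, 0 < μ ∧ ∀ (a h : ℝ) (s : ℤ → ℤ) (p : ℕ) (ha : a ≠ 0) (hh : h ≠ 0) (hp : p ≠ 0) (hs : ∀ i : ℤ, s (i + p) = s i), 93 / 100 ≤ a → a ≤ 51 / 50 → 78 / 100 * a ≤ h → h ≤ 86 / 100 * a → (h ≤ 808 / 1000 * a ∨ 825 / 1000 * a ≤ h) → Literature.MathematicalPhysics.StatisticalMechanics.IsHaggSeq s → (⨅ Q : Literature.MathematicalPhysics.StatisticalMechanics.PeriodicConfiguration 3, Q.energyPerParticle (fun r => min 1 (max 0 (4 - 2 * r)) * Literature.MathematicalPhysics.StatisticalMechanics.lennardJones r)) + μ ≤ (Literature.MathematicalPhysics.StatisticalMechanics.barlowPeriodicConfiguration s ha hh hp hs).energyPerParticle (fun r => min 1 (max 0 (4 - 2 * r)) * Literature.MathematicalPhysics.StatisticalMechanics.lennardJones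 r) := by
  have hA := stub_barlowLayerSumsWindow
  have hB := stub_strainedMarginCert
  obtain ⟨μ, hμ, hcert⟩ := hB
  refine ⟨μ, hμ, ?_⟩
  intro a h s p ha hh hp hs ha1 ha2 hh1 hh2 hstr hhagg
  have ha0 : 0 < a := by linarith
  have hh0 : 0 < h := by linarith
  have h3 : 2 ≤ 3 * h := by linarith
  -- the word: `e(word) = e₀(a,h) + J₂(a,h) · α`
  have hword : (barlowPeriodicConfiguration s ha hh hp hs).energyPerParticle (fun r => min 1 (max 0 (4 - 2 * r)) * lennardJones r) =
      barlowBaseEnergy (fun r => min 1 (max 0 (4 - 2 * r)) * lennardJones r) a h + barlowCoupling (fun r => min 1 (max 0 (4 - 2 * r)) * lennardJones r) a h 2 * alignedFrequency s p 2 := by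
    rw [energyPerParticle_barlow_truncLJ_eq_average
      a h s p ha hh hp hs ha0 hh0, div_eq_inv_mul]
    exact barlowSiteEnergy_average_truncLJ_affine
      a h s p ha0 h3 hhagg hp hs
  -- the reference: `e(hcp a₀ h₀) = e₀(a₀,h₀) + J₂(a₀,h₀)`, and `e_χ* ≤ e(hcp a₀ h₀)`
  have ha0' : (977 / 1000 : ℝ) ≠ 0 := by norm_num
  have hh0' : (797 / 1000 : ℝ) ≠ 0 := by norm_num
  have href : (hcpPeriodicConfiguration ha0' hh0').energyPerParticle (fun r => min 1 (max 0 (4 - 2 * r)) * lennardJones r) =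
      barlowBaseEnergy (fun r => min 1 (max 0 (4 - 2 * r)) * lennardJones r) (977 / 1000) (797 / 1000) +
        barlowCoupling (fun r => min 1 (max 0 (4 - 2 * r)) * lennardJones r) (977 / 1000) (797 / 1000) 2 := by
    show (barlowPeriodicConfiguration alternatingHagg ha0' hh0' two_ne_zero
      alternatingHagg_periodic).energyPerParticle (fun r => min 1 (max 0 (4 - 2 * r)) * lennardJones r) = _
    rw [energyPerParticle_barlow_truncLJ_eq_average
        (977 / 1000) (797 / 1000) alternatingHagg 2 ha0' hh0' two_ne_zero alternatingHagg_periodic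
        (by norm_num) (by norm_num),
      div_eq_inv_mul,
      barlowSiteEnergy_average_truncLJ_affine
        (977 / 1000) (797 / 1000) alternatingHagg 2 (by norm_num) (by norm_num) isHaggSeq_alternating
        two_ne_zero alternatingHagg_periodic,
      alignedFrequency_alternatingHagg_two_two, mul_one]
  have hstar : (⨅ Q : PeriodicConfiguration 3, Q.energyPerParticle (fun r => min 1 (max 0 (4 - 2 * r)) * lennardJones r)) ≤
      (hcpPeriodicConfiguration ha0' hh0').energyPerParticle (fun r => min 1 (max 0 (4 - 2 * r)) * lennardJones r) :=
    ciInf_le stub_periodicStability _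
  -- the layer sums at `(a, h)` and at the reference, the certificate at `(a, h)`
  obtain ⟨hin, h11, h12, h02, hbase⟩ := hA a h ha1 (by linarith)
  obtain ⟨hin', h11', h12', h02', hbase'⟩ := hA (977 / 1000) (797 / 1000) (by norm_num) (by norm_num)
  obtain ⟨hc1, hc2⟩ := le_min_iff.1 (hcert a h ha1 ha2 hh1 hh2 hstr)
  have hα0 : 0 ≤ alignedFrequency s p 2 := by unfold alignedFrequency; positivity
  have hα1 := alignedFrequency_le_one s p 2
  -- `e₀(a,h) = F_fcc(a,h)`, `e₀ + J₂ = F_hcp`, at `(a,h)` and at the reference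
  have he0 : barlowBaseEnergy (fun r => min 1 (max 0 (4 - 2 * r)) * lennardJones r) a h =
      3 * (min 1 (max 0 (4 - 2 * a)) * lennardJones a) + 3 * (min 1 (max 0 (4 - 2 * (√3 * a))) * lennardJones (√3 * a)) + 3 * (min 1 (max 0 (4 - 2 * (2 * a))) * lennardJones (2 * a)) + 3 * (min 1 (max 0 (4 - 2 * (√(a ^ 2 / 3 + h ^ 2)))) * lennardJones (√(a ^ 2 / 3 + h ^ 2))) + 3 * (min 1 (max 0 (4 - 2 * (√(4 * a ^ 2 / 3 + h ^ 2)))) * lennardJones (√(4 * a ^ 2 / 3 + h ^ 2))) + 6 * (min 1 (max 0 (4 - 2 * (√(7 * a ^ 2 / 3 + h ^ 2)))) * lennardJones (√(7 * a ^ 2 / 3 + h ^ 2))) + 3 * (min 1 (max 0 (4 - 2 * (√(a ^ 2 / 3 + 4 * h ^ 2)))) * lennardJones (√(a ^ 2 / 3 + 4 * h ^ 2))) + 3 * (min 1 (max 0 (4 - 2 * (√(4 * a ^ 2 / 3 + 4 * h ^ 2)))) * lennardJones (√(4 * a ^ 2 / 3 + 4 * h ^ 2))) := by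
    rw [hbase, hin, h11, h12]; ring
  have heJ : barlowBaseEnergy (fun r => min 1 (max 0 (4 - 2 * r)) * lennardJones r) a h + barlowCoupling (fun r => min 1 (max 0 (4 - 2 * r)) * lennardJones r) a h 2 =
      3 * (min 1 (max 0 (4 - 2 * a)) * lennardJones a) + 3 * (min 1 (max 0 (4 - 2 * (√3 * a))) * lennardJones (√3 * a)) + 3 * (min 1 (max 0 (4 - 2 * (2 * a))) * lennardJones (2 * a)) + 3 * (min 1 (max 0 (4 - 2 * (√(a ^ 2 / 3 + h ^ 2)))) * lennardJones (√(a ^ 2 / 3 + h ^ 2))) + 3 * (min 1 (max 0 (4 - 2 * (√(4 * a ^ 2 / 3 + h ^ 2)))) * lennardJones (√(4 * a ^ 2 / 3 + h ^ 2))) + 6 * (min 1 (max 0 (4 - 2 * (√(7 * a ^ 2 / 3 + h ^ 2)))) * lennardJones (√(7 * a ^ 2 / 3 + h ^ 2))) + (min 1 (max 0 (4 - 2 * (2 * h))) * lennardJones (2 * h)) + 6 * (min 1 (max 0 (4 - 2 * (√(a ^ 2 + 4 * h ^ 2)))) * lennardJones (√(a ^ 2 + 4 * h ^ 2))) := by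
    rw [barlowCoupling, hbase, hin, h11]; push_cast; rw [h02, h12]; ring
  have heR : barlowBaseEnergy (fun r => min 1 (max 0 (4 - 2 * r)) * lennardJones r) (977 / 1000) (797 / 1000) +
      barlowCoupling (fun r => min 1 (max 0 (4 - 2 * r)) * lennardJones r) (977 / 1000) (797 / 1000) 2 =
      3 * (min 1 (max 0 (4 - 2 * (977 / 1000))) * lennardJones (977 / 1000)) + 3 * (min 1 (max 0 (4 - 2 * (√3 * (977 / 1000)))) * lennardJones (√3 * (977 / 1000))) + 3 * (min 1 (max 0 (4 - 2 * (2 * (977 / 1000)))) * lennardJones (2 * (977 / 1000))) + 3 * (min 1 (max 0 (4 - 2 * (√((977 / 1000) ^ 2 / 3 + (797 / 1000) ^ 2)))) * lennardJones (√((977 / 1000) ^ 2 / 3 + (797 / 1000) ^ 2))) + 3 * (min 1 (max 0 (4 - 2 * (√(4 * (977 / 1000) ^ 2 / 3 + (797 / 1000) ^ 2)))) * lennardJones (√(4 * (977 / 1000) ^ 2 / 3 + (797 / 1000) ^ 2))) + 6 * (min 1 (max 0 (4 - 2 * (√(7 * (977 / 1000) ^ 2 / 3 + (797 / 1000) ^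 2)))) * lennardJones (√(7 * (977 / 1000) ^ 2 / 3 + (797 / 1000) ^ 2))) + (min 1 (max 0 (4 - 2 * (2 * (797 / 1000)))) * lennardJones (2 * (797 / 1000))) + 6 * (min 1 (max 0 (4 - 2 * (√((977 / 1000) ^ 2 + 4 * (797 / 1000) ^ 2)))) * lennardJones (√((977 / 1000) ^ 2 + 4 * (797 / 1000) ^ 2))) := by
    rw [barlowCoupling, hbase', hin', h11']; push_cast; rw [h02', h12']; ring
  have hc1' : (hcpPeriodicConfiguration ha0' hh0').energyPerParticle (fun r => min 1 (max 0 (4 - 2 * r)) * lennardJones r) + μ ≤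
      barlowBaseEnergy (fun r => min 1 (max 0 (4 - 2 * r)) * lennardJones r) a h := by
    rw [href, heR, he0]; exact hc1
  have hc2' : (hcpPeriodicConfiguration ha0' hh0').energyPerParticle (fun r => min 1 (max 0 (4 - 2 * r)) * lennardJones r) + μ ≤
      barlowBaseEnergy (fun r => min 1 (max 0 (4 - 2 * r)) * lennardJones r) a h + barlowCoupling (fun r => min 1 (max 0 (4 - 2 * r)) * lennardJones r) a h 2 := by
    rw [href, heR, heJ]; exact hc2
  rw [hword]
  rcases le_total 0 (barlowCoupling (fun r => min 1 (max 0 (4 - 2 * r)) * lennardJones r) a h 2) with hJ | hJ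
  · have hJα := mul_nonneg hJ hα0
    linarith
  · have hJα := mul_le_mul_of_nonpos_left hα1 hJ
    rw [mul_one] at hJα
    linarith

end Summit.AtomisticToContinuum.Crystallization.Theorems.PricedLinkCensusTruncatedCensusGap
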